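import Mathlib.Analysis.SpecialFunctions.Complex.Arg
import Mathlib.Analysis.Normed.Group.InfiniteSum
import Mathlib.Topology.Algebra.InfiniteSum.NatInt
import HarnessLib

/-!
# Greedy steering of phases (a fixed-point-free replacement of Saias–Weingartner's Lemmas 1–2)

Topic `Literature/NumberTheory/LFunctions` (namespace `Literature.NumberTheory.LFunctions`).
Everything in this file is PROVED; there are no definitions and no named facts.

Saias–Weingartner, *Zeros of Dirichlet series with periodic coefficients*, Acta Arith. 140
(2009), §3, solve the system "`∏_{p>y} (1 - χ_j(p) p^{-σ-it_p})⁻¹ = z_j` for all `j`" in the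
real unknowns `(t_p)_{p>y}` (Lemma 2) by first solving the linearised system continuously in the
data (Lemma 1, from the prime number theorem for arithmetic progressions) and then absorbing the
second-order terms with the Brouwer fixed point theorem. This file proves an abstract
combinatorial lemma which replaces both steps by a GREEDY choice of the phases, one index at a
time: at step `k` the phase `θ_k` is the argument of the current error in the coordinate `u k`
("aim the next term at what is still missing"). If every remaining budget dominates the term in
hand plus all future second-order drift (a Kakeya-type condition, `hstep`), the error in
coordinate `a` after step `K` is at most the remaining budget of `a` minus the remaining drift
(`norm_state_le`), hence tends to `0`, and the series of chosen terms sums EXACTLY to the target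
(`exists_phases_hasSum`). The number-theoretic verification of the budget conditions for
`r_p = p^{-σ}` on the primes of a reduced residue class is in the sibling file
`SaiasWeingartnerBudget.lean`; the application to Theorem 2 of the paper is in
`SaiasWeingartnerProofs.lean`.

## Main result

* `Literature.NumberTheory.LFunctions.SWSteering.exists_phases_hasSum` — given classes
  `u : ℕ → A`, radii `r ≥ 0` (summable), drifts `D k θ : A → ℂ` bounded by a summable `δ`,
  targets `w` with `‖w a‖ + ∑ δ ≤ ∑_{u k = a} r k`, and the step condition
  `r k + ∑_{m ≥ k} δ m ≤ ∑_{m > k, u m = u k} r m` whenever `r k > 0`, there are phases `θ`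
  with `∑_k ([u k = a] r_k e^{iθ_k} + D k θ_k a) = w a` for every `a`.

## References

* [SaiasWeingartner2009] E. Saias, A. Weingartner, Acta Arith. 140 (2009), 335–344, §3
  (Lemmas 1–2; replaced here by the greedy argument above).
-/

noncomputable section

open Complex Filter Finset
open scoped Topology

namespace Literature.NumberTheory.LFunctions

namespace SWSteering

variable {A : Type*} [DecidableEq A]

/-- One complex number aimed at another: `‖c - r e^{i arg c}‖ = |‖c‖ - r|`. [folklore] -/
theorem norm_sub_mul_exp_arg (c : ℂ) (r : ℝ) :
    ‖c - r * exp (arg c * I)‖ = |‖c‖ - r| := by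
  have h : c - r * exp (arg c * I) = ((‖c‖ - r : ℝ) : ℂ) * exp (arg c * I) := by
    calc c - r * exp (arg c * I) = ‖c‖ * exp (arg c * I) - r * exp (arg c * I) := by
          rw [norm_mul_exp_arg_mul_I]
      _ = ((‖c‖ - r : ℝ) : ℂ) * exp (arg c * I) := by push_cast; ring
  rw [h, norm_mul, norm_exp_ofReal_mul_I, mul_one, norm_real, Real.norm_eq_abs]

/-- Tail sums `∑_{m} f (m + K)` of a summable sequence satisfy the one-step recursion.
[folklore] -/
theorem tsum_nat_add_eq_add_tsum_succ {f : ℕ → ℝ} (hf : Summable f) (K : ℕ) :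
    ∑' m, f (m + K) = f K + ∑' m, f (m + (K + 1)) := by
  have hs : Summable fun m ↦ f (m + K) := (summable_nat_add_iff K).2 hf
  rw [hs.tsum_eq_zero_add]
  simp only [zero_add]
  congr 1
  refine tsum_congr fun m ↦ ?_
  congr 1
  ring

/-- **Greedy steering, the invariant.** With the greedy phases, the error in coordinate `a`
after `K` steps is at most the remaining budget of `a` minus the remaining drift.
(Replacement of [SaiasWeingartner2009], Lemmas 1–2.) [folklore] -/
theorem norm_state_le {u : ℕ → A} {r δ : ℕ → ℝ} {D : ℕ → ℝ → A → ℂ} {w : A → ℂ}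
    (hr : ∀ k, 0 ≤ r k) (hrs : Summable r) (hδs : Summable δ)
    (hD : ∀ k θ a, ‖D k θ a‖ ≤ δ k)
    (hw : ∀ a, ‖w a‖ + ∑' k, δ k ≤ ∑' k, if u k = a then r k else 0)
    (hstep : ∀ k, 0 < r k →
      r k + ∑' m, δ (m + k) ≤ ∑' m, if u (m + (k + 1)) = u k then r (m + (k + 1)) else 0)
    (st : ℕ → A → ℂ) (hst0 : st 0 = w)
    (hst : ∀ k a, st (k + 1) a = st k a
      - (if u k = a then (r k : ℂ) * exp (arg (st k (u k)) * I) else 0)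
      - D k (arg (st k (u k))) a)
    (K : ℕ) (a : A) :
    ‖st K a‖ ≤ (∑' m, if u (m + K) = a then r (m + K) else 0) - ∑' m, δ (m + K) := by
  -- summability of the budget sequence of `a`
  have hRa : Summable fun k ↦ if u k = a then r k else 0 := by
    refine hrs.of_nonneg_of_le (fun k ↦ ?_) fun k ↦ ?_
    · split_ifs <;> simp [hr k]
    · split_ifs <;> simp [hr k]
  induction K with
  | zero =>
    simp only [add_zero, hst0]
    linarith [hw a]
  | succ K ih =>
    have hRrec := tsum_nat_add_eq_add_tsum_succ hRa K
    have hδrec := tsum_nat_add_eq_add_tsum_succ hδs K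
    have hmain : ‖st (K + 1) a‖ ≤
        ‖st K a - (if u K = a then (r K : ℂ) * exp (arg (st K (u K)) * I) else 0)‖ + δ K := by
      rw [hst K a]
      exact (norm_sub_le _ _).trans (add_le_add le_rfl (hD K _ a))
    by_cases hua : u K = a
    · -- the active coordinate
      rw [if_pos hua] at hmain hRrec
      have hK : st K (u K) = st K a := by rw [hua]
      have hnorm : ‖st K a - (r K : ℂ) * exp (arg (st K (u K)) * I)‖ = |‖st K a‖ - r K| := by
        rw [hK]; exact norm_sub_mul_exp_arg _ _
      rw [hnorm] at hmain
      rcases le_or_gt (r K) ‖st K a‖ with hle | hlt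
      · rw [abs_of_nonneg (sub_nonneg.2 hle)] at hmain
        linarith
      · rw [abs_of_neg (sub_neg.2 hlt)] at hmain
        have hpos : 0 < r K := lt_of_le_of_lt (norm_nonneg _) hlt
        have h3 := hstep K hpos
        rw [hua] at h3
        linarith [norm_nonneg (st K a)]
    · rw [if_neg hua] at hmain hRrec
      rw [sub_zero] at hmain
      linarith

/-- Partial sums of the chosen terms: `∑_{k<K} termₖ = w - st K`. [folklore] -/
theorem sum_range_terms_eq {u : ℕ → A} {r : ℕ → ℝ} {D : ℕ → ℝ → A → ℂ} {w : A → ℂ}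
    (st : ℕ → A → ℂ) (hst0 : st 0 = w)
    (hst : ∀ k a, st (k + 1) a = st k a
      - (if u k = a then (r k : ℂ) * exp (arg (st k (u k)) * I) else 0)
      - D k (arg (st k (u k))) a)
    (K : ℕ) (a : A) :
    ∑ k ∈ range K, ((if u k = a then (r k : ℂ) * exp (arg (st k (u k)) * I) else 0)
      + D k (arg (st k (u k))) a) = w a - st K a := by
  induction K with
  | zero => simp [hst0]
  | succ K ih => rw [sum_range_succ, ih, hst K a]; ring

/-- **Greedy steering** (replaces [SaiasWeingartner2009], §3, Lemmas 1–2 and the Brouwer fixed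
point theorem). Let `u : ℕ → A` assign a class to every index, `r k ≥ 0` summable radii,
`D k θ a` drifts with `‖D k θ a‖ ≤ δ k`, `δ` summable, and targets `w` with
`‖w a‖ + ∑ₖ δ k ≤ ∑_{u k = a} r k` for every class `a`. If, whenever `r k > 0`,
`r k + ∑_{m ≥ k} δ m ≤ ∑_{m > k, u m = u k} r m`, then there are real phases `θ k` with
`∑ₖ ([u k = a] r k e^{iθ_k} + D k θ_k a) = w a` for every `a`. [folklore] -/
theorem exists_phases_hasSum [Fintype A] {u : ℕ → A} {r δ : ℕ → ℝ} {D : ℕ → ℝ → A → ℂ}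
    {w : A → ℂ} (hr : ∀ k, 0 ≤ r k) (hrs : Summable r) (hδs : Summable δ)
    (hD : ∀ k θ a, ‖D k θ a‖ ≤ δ k)
    (hw : ∀ a, ‖w a‖ + ∑' k, δ k ≤ ∑' k, if u k = a then r k else 0)
    (hstep : ∀ k, 0 < r k →
      r k + ∑' m, δ (m + k) ≤ ∑' m, if u (m + (k + 1)) = u k then r (m + (k + 1)) else 0) :
    ∃ θ : ℕ → ℝ, ∀ a, HasSum (fun k ↦ (if u k = a then (r k : ℂ) * exp (θ k * I) else 0)
      + D k (θ k) a) (w a) := by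
  -- the greedy recursion
  let step : ℕ → (A → ℂ) → (A → ℂ) := fun k c a ↦
    c a - (if u k = a then (r k : ℂ) * exp (arg (c (u k)) * I) else 0) - D k (arg (c (u k))) a
  let st : ℕ → A → ℂ := fun k ↦ Nat.rec w (fun k c ↦ step k c) k
  have hst0 : st 0 = w := rfl
  have hst : ∀ k a, st (k + 1) a = st k a
      - (if u k = a then (r k : ℂ) * exp (arg (st k (u k)) * I) else 0)
      - D k (arg (st k (u k))) a := fun k a ↦ rfl
  refine ⟨fun k ↦ arg (st k (u k)), fun a ↦ ?_⟩
  have hδ0 : ∀ k, 0 ≤ δ k := fun k ↦ (norm_nonneg _).trans (hD k 0 a)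
  -- the terms are absolutely summable
  have hsumm : Summable fun k ↦ ‖(if u k = a then (r k : ℂ) * exp (arg (st k (u k)) * I)
      else 0) + D k (arg (st k (u k))) a‖ := by
    refine (hrs.add hδs).of_nonneg_of_le (fun k ↦ norm_nonneg _) fun k ↦ ?_
    refine (norm_add_le _ _).trans (add_le_add ?_ (hD k _ a))
    split_ifs
    · rw [norm_mul, norm_exp_ofReal_mul_I, mul_one, norm_real, Real.norm_eq_abs,
        abs_of_nonneg (hr k)]
    · simp [hr k]
  rw [hasSum_iff_tendsto_nat_of_summable_norm hsumm]
  have heq : (fun n ↦ ∑ k ∈ range n, ((if u k = a then (r k : ℂ) * exp (arg (st k (u k)) * I)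
      else 0) + D k (arg (st k (u k))) a)) = fun n ↦ w a - st n a :=
    funext fun n ↦ sum_range_terms_eq st hst0 hst n a
  rw [heq]
  have hlim : Tendsto (fun n ↦ st n a) atTop (𝓝 0) := by
    have hRa : Summable fun k ↦ if u k = a then r k else 0 := by
      refine hrs.of_nonneg_of_le (fun k ↦ ?_) fun k ↦ ?_
      · split_ifs <;> simp [hr k]
      · split_ifs <;> simp [hr k]
    have hbound : ∀ K, ‖st K a‖ ≤ ∑' m, if u (m + K) = a then r (m + K) else 0 := by
      intro K
      have h := norm_state_le hr hrs hδs hD hw hstep st hst0 hst K a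
      have : 0 ≤ ∑' m, δ (m + K) := tsum_nonneg fun m ↦ hδ0 _
      linarith
    have htail := tendsto_sum_nat_add fun k ↦ if u k = a then r k else 0
    refine squeeze_zero_norm hbound ?_
    simpa using htail
  simpa using (tendsto_const_nhds (x := w a)).sub hlim

end SWSteering

end Literature.NumberTheory.LFunctions
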